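import Literature.NumberTheory.Automorphic.ResGLnCuspidalEigenclassOfComparison
import Literature.NumberTheory.Automorphic.TwistedQuotientConeClass
import Literature.NumberTheory.Automorphic.ResGLnHermitianCone
import Literature.NumberTheory.Automorphic.GL2CCoeffRepComplex
import HarnessLib

/-!
# `ResGLnCohomology.cuspidalEigenclass_exists` from a CONE EIGENFAMILY with non-zero cone class

Topic `NumberTheory/Automorphic`; namespace `Literature.NumberTheory.Automorphic.ResGLnCohomology`.
Theorems only (no definition, no named fact, no `sorry`).

`ResGLnCuspidalEigenclassOfComparison` reduced the named fact
`ResGLnCohomology.cuspidalEigenclass_exists` (Clozel 1990, Lemme 3.15 / Borel–Wallach VII 2.7 /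
Borel's injectivity) to the COMPARISON for one spherical eigenform: a non-zero Hecke eigenclass
`x ∈ H^q(S_{K_f(𝔫)}, Ẽ_λ) = levelCohomology ℂ n K 𝔫 λ q` with prescribed eigenvalues.  With the tree's
explicit degree-`q` de Rham → group-cohomology map on the hermitian cone now available
(`TwistedQuotientConeClass`: the cone class `coneClass hω x₀ ∈ TwistedQuotient.cohomology ι L ρ q` of an
`IsConeFormFamily ω`, Hecke-equivariant by `heckeEnd_coneClass_eq_smul`; `ResGLnHermitianCone`: the
positive cone `posCone n K ⊆ hermSpace n K` with the LINEAR action `coneActionRat` of `GL_n(K)`,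
`H ↦ γ H γᴴ`), the comparison hypothesis takes a concrete analytic shape — no abstract linear map
from `(𝔤, K_∞)`-cohomology is needed any more:

> (C) for `π` cuspidal on `GL_n(𝔸_K)` of cohomological type `λ^∨ + ρ` (`n ≥ 1`, `𝔫 ≠ 0`, `λ_τ`
> dominant) and a `K(𝔫)`-spherical `φ ∈ W ∖ W'` which is an eigenform modulo `W'` of the
> `T_{v,i}(ϖ_v)`, `v ∤ 𝔫`, with eigenvalues `c_{v,i}`, there are a degree `q` and a family
> `ω = (ω_c)_{c ∈ GL_n(𝔸_K^∞)}` of `E_λ(ℂ)`-valued differential `q`-forms on `hermSpace n K` which is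
> an `IsConeFormFamily` for (`GL_n(K)⁺ →[diag] GL_n(𝔸_K^∞) ⊇ K_f(𝔫)`, `E_λ|GL_n(K)⁺`, `coneActionRat`,
> `posCone`), a `[K_f(𝔫) t_{v,i} K_f(𝔫)]`-eigenfamily in `c` with eigenvalues `c_{v,i}`, and has
> NON-ZERO cone class at the base point `1`

— the Eichler–Shimura–Borel–Wallach dictionary (the closed `E_λ`-valued form `E(g_∞) ⊗ φ` attached
to a non-zero `K_∞`-equivariant `(𝔤, K_∞)`-cocycle of `π_∞ ⊗ E_λ`, Clozel's Lemme 3.14) together with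
Borel's injectivity of cuspidal cohomology ("a cuspidal harmonic form is not a coboundary")
[cite: BorelWallach2000, VII 2.4–2.7] [cite: Borel1983Regularization, Thm. 5.3 and Cor. 5.5]
[cite: Clozel1990, Lemme 3.14, Lemme 3.15 and §3.5 (pp. 120–123)] [cite: Dupont1976, §1–2].

THIS FILE proves

* `ResGLnCohomology.eigenclass_of_coneEigenfamily` — POINTWISE: a cone eigenfamily with non-zero cone
  class gives the non-zero Hecke eigenclass `x = coneClass` in `levelCohomology ℂ n K 𝔫 λ q`
  (`levelCohomology` IS `TwistedQuotient.cohomology (diagPos) (level) (coeffRepPos)`, and `heckeT`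
  IS `TwistedQuotient.heckeEnd … (heckeElement n K v i)`);
* `ResGLnCohomology.cuspidalEigenclass_exists_of_coneEigenfamily (hC : (C)) : cuspidalEigenclass_exists`.

So the discharge `cuspidalEigenclass_exists_holds` is one line from a theorem (C).

## References

* L. Clozel, *Motifs et formes automorphes* (1990), Lemme 3.14–3.15, §3.5. [Clozel1990]
* A. Borel, N. Wallach (2000), VII 2.4–2.7. [BorelWallach2000]
* A. Borel, Duke Math. J. 50 (1983), Thm. 5.3, Cor. 5.5. [Borel1983Regularization]
* J. L. Dupont, Topology 15 (1976), §1–2. [Dupont1976]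
-/

noncomputable section

open scoped Classical
open NumberField IsDedekindDomain

namespace Literature.NumberTheory.Automorphic

namespace ResGLnCohomology

open Literature.NumberTheory.DiophantineGeometry Literature.Barriers.Langlands BigHeckeGLn

/-- **A cone eigenfamily with non-zero cone class gives the Hecke eigenclass** (pointwise form): if
`ω` is an `IsConeFormFamily` of `E_λ(ℂ)`-valued `q`-forms on the hermitian space for
(`GL_n(K)⁺ →[diag] GL_n(𝔸_K^∞) ⊇ K_f(𝔫)`, `E_λ|GL_n(K)⁺`, `coneActionRat`, `posCone`) which is a
`[K_f(𝔫) t_{v,i} K_f(𝔫)]`-eigenfamily in the finite-adelic variable with eigenvalues `c_{v,i}`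
(`v ∤ 𝔫`, `i ≤ n`), and whose cone class at the base point `1` is non-zero, then that cone class is a
non-zero `x ∈ H^q(S_{K_f(𝔫)}, Ẽ_λ)` with `T_{v,i} x = c_{v,i} x`
(`TwistedQuotient.heckeEnd_coneClass_eq_smul`). [cite: BorelWallach2000, VII 2.4–2.7]
[cite: Dupont1976, §1–2] -/
theorem eigenclass_of_coneEigenfamily {n : ℕ} {K : Type} [Field K] [NumberField K]
    {𝔫 : Ideal (𝓞 K)} {lam : (K →+* ℂ) → Fin n → ℤ} {c : HeightOneSpectrum (𝓞 K) → ℕ → ℂ} {q : ℕ}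
    {ω : FiniteAdelicGL n K → ResGLnCone.hermSpace n K →
      (ResGLnCone.hermSpace n K) [⋀^Fin q]→L[ℝ] CoeffModule ℂ n K lam}
    (hω : TwistedQuotient.IsConeFormFamily (diagPos n K) (level n K 𝔫) (coeffRepPos ℂ n K lam)
      ((ResGLnCone.coneActionRat n K).comp (glTotPos n K).subtype) (ResGLnCone.posCone n K) ω)
    (hne : TwistedQuotient.coneClass hω (ResGLnCone.hermOne_mem_posCone n K) ≠ 0)
    (heig : ∀ v : HeightOneSpectrum (𝓞 K), ¬ v.asIdeal ∣ 𝔫 → ∀ i ≤ n,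
      ∀ (cL : FiniteAdelicGL n K ⧸ level n K 𝔫), ∀ y ∈ ResGLnCone.posCone n K,
        ∀ vec : Fin q → ResGLnCone.hermSpace n K,
          ArithmeticQuotient.heckeFun ℂ (level n K 𝔫) (heckeElement n K v i) (CoeffModule ℂ n K lam)
            (fun c' => ω c'.out y vec) cL = c v i • ω cL.out y vec) :
    ∃ x : levelCohomology ℂ n K 𝔫 lam q, x ≠ 0 ∧
      ∀ v : HeightOneSpectrum (𝓞 K), ¬ v.asIdeal ∣ 𝔫 → ∀ i ≤ n,
        heckeT ℂ n K 𝔫 lam q v i x = c v i • x :=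
  ⟨TwistedQuotient.coneClass hω (ResGLnCone.hermOne_mem_posCone n K), hne, fun v hv i hi =>
    TwistedQuotient.heckeEnd_coneClass_eq_smul hω (ResGLnCone.hermOne_mem_posCone n K)
      (heig v hv i hi)⟩

/-- **`ResGLnCohomology.cuspidalEigenclass_exists` from the cone-eigenfamily realisation (C).**
Hypothesis `hC` (NOT yet a theorem of the tree — the Borel–Wallach dictionary with Clozel's
Lemme 3.14 and Borel's injectivity, in the cone model): for `n ≥ 1`, `𝔫 ≠ 0`, `λ` dominant, a
cuspidal `π` of cohomological type and a `K(𝔫)`-spherical eigenform `φ ∈ W ∖ W'` modulo `W'` with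
eigenvalues `c_{v,i}`, there are `q` and an `IsConeFormFamily` of `E_λ(ℂ)`-valued `q`-forms on the
hermitian space, `[K_f(𝔫) t_{v,i} K_f(𝔫)]`-eigen with eigenvalues `c_{v,i}` and with non-zero cone
class.  Conclusion: the named fact, through `cuspidalEigenclass_exists_of_eigenformComparison` and
`eigenclass_of_coneEigenfamily`. [cite: Clozel1990, Lemme 3.14, Lemme 3.15 and §3.5 (pp. 120–123)]
[cite: BorelWallach2000, VII 2.4–2.7] [cite: Borel1983Regularization, Thm. 5.3 and Cor. 5.5] -/
theorem cuspidalEigenclass_exists_of_coneEigenfamily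
    (hC : ∀ (n : ℕ) (K : Type) [Field K] [NumberField K] (hcpt : isCompact_glFiniteIntegralLevel n K)
      (𝔫 : Ideal (𝓞 K)) (lam : (K →+* ℂ) → Fin n → ℤ), 1 ≤ n → 𝔫 ≠ 0 →
      (∀ τ, Weight.IsDominant (lam τ)) →
      ∀ π : CuspidalAutomorphicRepData n K hcpt,
        (∃ T : InfinityType K n, π.1.HasInfinityType T ∧
          ∀ τ : K →+* ℂ, (T τ).map ArchWeight.a =
            (cohomologicalInfinityType n K (Weight.dual (lam τ)) τ).map ArchWeight.a) →
        ∀ φ ∈ π.1.W, φ ∉ π.1.W' →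
          (∀ u ∈ principalCongruenceLevel n K 𝔫,
            rightTranslation (AdelicGroupData.gl n K) u φ = φ) →
          ∀ c : HeightOneSpectrum (𝓞 K) → ℕ → ℂ,
            (∀ v : HeightOneSpectrum (𝓞 K), ¬ v.asIdeal ∣ 𝔫 → ∀ i ≤ n,
              heckeOperator (rightTranslation (AdelicGroupData.gl n K))
                  (principalCongruenceLevel n K 𝔫)
                  (heckeDiagAt n K v (uniformizerAt v) i) φ - c v i • φ ∈ π.1.W') →
            ∃ (q : ℕ) (ω : FiniteAdelicGL n K → ResGLnCone.hermSpace n K →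
                (ResGLnCone.hermSpace n K) [⋀^Fin q]→L[ℝ] CoeffModule ℂ n K lam)
              (hω : TwistedQuotient.IsConeFormFamily (diagPos n K) (level n K 𝔫)
                (coeffRepPos ℂ n K lam)
                ((ResGLnCone.coneActionRat n K).comp (glTotPos n K).subtype)
                (ResGLnCone.posCone n K) ω),
              TwistedQuotient.coneClass hω (ResGLnCone.hermOne_mem_posCone n K) ≠ 0 ∧
              ∀ v : HeightOneSpectrum (𝓞 K), ¬ v.asIdeal ∣ 𝔫 → ∀ i ≤ n,
                ∀ (cL : FiniteAdelicGL n K ⧸ level n K 𝔫), ∀ y ∈ ResGLnCone.posCone n K,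
                  ∀ vec : Fin q → ResGLnCone.hermSpace n K,
                    ArithmeticQuotient.heckeFun ℂ (level n K 𝔫) (heckeElement n K v i)
                      (CoeffModule ℂ n K lam) (fun c' => ω c'.out y vec) cL = c v i • ω cL.out y vec) :
    cuspidalEigenclass_exists := by
  refine cuspidalEigenclass_exists_of_eigenformComparison ?_
  intro n K _ _ hcpt 𝔫 lam hn h𝔫 hlam π hT φ hφW hφW' hfix c hc
  obtain ⟨q, ω, hω, hne, heig⟩ := hC n K hcpt 𝔫 lam hn h𝔫 hlam π hT φ hφW hφW' hfix c hc
  exact ⟨q, eigenclass_of_coneEigenfamily hω hne heig⟩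

end ResGLnCohomology

end Literature.NumberTheory.Automorphic

end
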